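import Summits.Ventures.PackingBounds.Configurations.OrthogonalPentagonsWalk
import Summits.Ventures.PackingBounds.Configurations.GramIsometry
import HarnessLib

/-!
# Ten-point `{0, cos 72°, cos 144°}`-codes in `ℝ⁴` with centre of mass `0` are two orthogonal regular pentagons (part 2: structure and uniqueness)

Framing: lottery ticket; floor = certified bounds/negative ranges. Venture `PackingBounds` (cell
`pub-packcert`, seat `pub-packcert-energy` gen 14). Continues `OrthogonalPentagonsWalk`: the `144°`-walk from a
`c₂`-pair of a code `C` (`IsCode C`: unit vectors, inner products in `{0, c₁, c₂}`, vanishing Gram row sums) stays in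
`C` (`wk_mem`), its five points are distinct (`wk_ne`) and exhaust the non-orthogonal partners of each of them, so every
other point of `C` is orthogonal to the pentagon (`inner_wk_eq_zero`); a ten-point code is therefore the disjoint union of
two such pentagons in orthogonal planes (`structure_thm`), and any two ten-point codes are related by a linear isometry
of `ℝ⁴` (`isometric`, Gram-matrix equality of the two labellings + `Config.exists_linearIsometryEquiv_of_inner_eq`).
Used by `Energy.TenPointCkFour/FiveGroundState` (ground states of the `(1+t)^4`, `(1+t)^5` energies of ten points on `S³`).
-/

noncomputable section

namespace Summit.Ventures.PackingBounds.Config.OrthogonalPentagonsUnique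

open Finset
open scoped RealInnerProductSpace

/-! ### The walk inside a code -/

section code
variable {C : Finset E4}

/-- Distinct walk points: `p_i ≠ p_j` for `i ≠ j ≤ 4` (their inner product is `c₁` or `c₂`, not `1`). -/
theorem wk_ne {x0 x1 : E4} (h0 : ‖x0‖ = 1) (h1 : ‖x1‖ = 1) (h01 : inner ℝ x0 x1 = ctwo)
    {i j : ℕ} (hi : i ≤ 4) (hj : j ≤ 4) (hij : i ≠ j) : wk x0 x1 i ≠ wk x0 x1 j := by
  intro h
  have a := inner_wk h0 h1 h01 i j hi hj
  have b := inner_wk h0 h1 h01 j j hj hj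
  rw [h] at a
  rw [a] at b
  interval_cases i <;> interval_cases j <;> simp only [gv] at b <;>
    first | exact absurd rfl hij | linarith [cone_lt_one, ctwo_neg]

/-- The walk from a `c₂`-pair of `C` stays in `C`. -/
theorem wk_mem (hC : IsCode C) {x0 x1 : E4} (hx0 : x0 ∈ C) (hx1 : x1 ∈ C) (h01 : inner ℝ x0 x1 = ctwo) :
    ∀ i, i ≤ 4 → wk x0 x1 i ∈ C := by
  have h10 : inner ℝ x1 x0 = ctwo := by rw [real_inner_comm]; exact h01
  obtain ⟨h2, h12⟩ := step_mem hC hx1 hx0 h10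
  obtain ⟨h3, h23⟩ := step_mem hC h2 hx1 (by rw [real_inner_comm]; exact h12)
  obtain ⟨h4, _⟩ := step_mem hC h3 h2 (by rw [real_inner_comm]; exact h23)
  intro i hi
  interval_cases i
  · exact hx0
  · exact hx1
  · exact h2
  · exact h3
  · exact h4

/-- A point with two known `c₂`-partners and two known `c₁`-partners is orthogonal to every other point. -/
theorem inner_eq_zero_of_partners (hC : IsCode C) {u v1 v2 w1 w2 z : E4} (hu : u ∈ C)
    (hv1 : v1 ∈ C) (hv2 : v2 ∈ C) (hw1 : w1 ∈ C) (hw2 : w2 ∈ C) (hz : z ∈ C)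
    (h1 : inner ℝ u v1 = ctwo) (h2 : inner ℝ u v2 = ctwo) (hv12 : v1 ≠ v2)
    (h3 : inner ℝ u w1 = cone) (h4 : inner ℝ u w2 = cone) (hw12 : w1 ≠ w2)
    (hz1 : z ≠ v1) (hz2 : z ≠ v2) (hz3 : z ≠ w1) (hz4 : z ≠ w2) (hzu : z ≠ u) :
    inner ℝ u z = 0 := by
  rcases hC.vals u hu z hz hzu.symm with h | h | h
  · exact h
  · rcases partner_eq hC cone_lt_one.ne hu (deg_eq_two hC hu).2 hw1 hw2 hw12 h3 h4 hz h with e | e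
    · exact absurd e hz3
    · exact absurd e hz4
  · rcases partner_eq hC (by linarith [ctwo_neg] : ctwo ≠ 1) hu (deg_eq_two hC hu).1 hv1 hv2 hv12 h1 h2 hz h
      with e | e
    · exact absurd e hz1
    · exact absurd e hz2

/-- **Exhaustion.** A point of `C` outside the pentagon `{p₀,…,p₄}` is orthogonal to all of it: the two `c₂`- and
the two `c₁`-partners of `p_i` are `p_{i±1}` and `p_{i±2}`. -/
theorem inner_wk_eq_zero (hC : IsCode C) {x0 x1 : E4} (hx0 : x0 ∈ C) (hx1 : x1 ∈ C) (h01 : inner ℝ x0 x1 = ctwo)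
    {z : E4} (hz : z ∈ C) (hne : ∀ i, i ≤ 4 → z ≠ wk x0 x1 i) :
    ∀ i, i ≤ 4 → inner ℝ (wk x0 x1 i) z = 0 := by
  have h0 := hC.norm_one x0 hx0
  have h1 := hC.norm_one x1 hx1
  have hg := inner_wk h0 h1 h01
  have hm := wk_mem hC hx0 hx1 h01
  have hn := fun (i j : ℕ) (hi : i ≤ 4) (hj : j ≤ 4) (hij : i ≠ j) => wk_ne h0 h1 h01 hi hj hij
  intro i hi
  interval_cases i
  · exact inner_eq_zero_of_partners hC (hm 0 (by norm_num)) (hm 1 (by norm_num)) (hm 4 (by norm_num))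
      (hm 2 (by norm_num)) (hm 3 (by norm_num)) hz
      (by rw [hg 0 1 (by norm_num) (by norm_num)]; rfl) (by rw [hg 0 4 (by norm_num) (by norm_num)]; rfl)
      (hn 1 4 (by norm_num) (by norm_num) (by norm_num))
      (by rw [hg 0 2 (by norm_num) (by norm_num)]; rfl) (by rw [hg 0 3 (by norm_num) (by norm_num)]; rfl)
      (hn 2 3 (by norm_num) (by norm_num) (by norm_num))
      (hne 1 (by norm_num)) (hne 4 (by norm_num)) (hne 2 (by norm_num)) (hne 3 (by norm_num)) (hne 0 (by norm_num))
  · exact inner_eq_zero_of_partners hC (hm 1 (by norm_num)) (hm 0 (by norm_num)) (hm 2 (by norm_num))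
      (hm 3 (by norm_num)) (hm 4 (by norm_num)) hz
      (by rw [hg 1 0 (by norm_num) (by norm_num)]; rfl) (by rw [hg 1 2 (by norm_num) (by norm_num)]; rfl)
      (hn 0 2 (by norm_num) (by norm_num) (by norm_num))
      (by rw [hg 1 3 (by norm_num) (by norm_num)]; rfl) (by rw [hg 1 4 (by norm_num) (by norm_num)]; rfl)
      (hn 3 4 (by norm_num) (by norm_num) (by norm_num))
      (hne 0 (by norm_num)) (hne 2 (by norm_num)) (hne 3 (by norm_num)) (hne 4 (by norm_num)) (hne 1 (by norm_num))
  · exact inner_eq_zero_of_partners hC (hm 2 (by norm_num)) (hm 1 (by norm_num)) (hm 3 (by norm_num))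
      (hm 0 (by norm_num)) (hm 4 (by norm_num)) hz
      (by rw [hg 2 1 (by norm_num) (by norm_num)]; rfl) (by rw [hg 2 3 (by norm_num) (by norm_num)]; rfl)
      (hn 1 3 (by norm_num) (by norm_num) (by norm_num))
      (by rw [hg 2 0 (by norm_num) (by norm_num)]; rfl) (by rw [hg 2 4 (by norm_num) (by norm_num)]; rfl)
      (hn 0 4 (by norm_num) (by norm_num) (by norm_num))
      (hne 1 (by norm_num)) (hne 3 (by norm_num)) (hne 0 (by norm_num)) (hne 4 (by norm_num)) (hne 2 (by norm_num))
  · exact inner_eq_zero_of_partners hC (hm 3 (by norm_num)) (hm 2 (by norm_num)) (hm 4 (by norm_num))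
      (hm 0 (by norm_num)) (hm 1 (by norm_num)) hz
      (by rw [hg 3 2 (by norm_num) (by norm_num)]; rfl) (by rw [hg 3 4 (by norm_num) (by norm_num)]; rfl)
      (hn 2 4 (by norm_num) (by norm_num) (by norm_num))
      (by rw [hg 3 0 (by norm_num) (by norm_num)]; rfl) (by rw [hg 3 1 (by norm_num) (by norm_num)]; rfl)
      (hn 0 1 (by norm_num) (by norm_num) (by norm_num))
      (hne 2 (by norm_num)) (hne 4 (by norm_num)) (hne 0 (by norm_num)) (hne 1 (by norm_num)) (hne 3 (by norm_num))
  · exact inner_eq_zero_of_partners hC (hm 4 (by norm_num)) (hm 3 (by norm_num)) (hm 0 (by norm_num))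
      (hm 1 (by norm_num)) (hm 2 (by norm_num)) hz
      (by rw [hg 4 3 (by norm_num) (by norm_num)]; rfl) (by rw [hg 4 0 (by norm_num) (by norm_num)]; rfl)
      (hn 3 0 (by norm_num) (by norm_num) (by norm_num))
      (by rw [hg 4 1 (by norm_num) (by norm_num)]; rfl) (by rw [hg 4 2 (by norm_num) (by norm_num)]; rfl)
      (hn 1 2 (by norm_num) (by norm_num) (by norm_num))
      (hne 3 (by norm_num)) (hne 0 (by norm_num)) (hne 1 (by norm_num)) (hne 2 (by norm_num)) (hne 4 (by norm_num))

/-- Membership in the walk pentagon `{p₀,…,p₄}`. -/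
theorem mem_wkSet {x0 x1 z : E4} : z ∈ ((Finset.range 5).image (wk x0 x1)) ↔ ∃ i, i ≤ 4 ∧ z = wk x0 x1 i := by
  simp only [Finset.mem_image, Finset.mem_range]
  constructor
  · rintro ⟨i, hi, rfl⟩; exact ⟨i, by omega, rfl⟩
  · rintro ⟨i, hi, rfl⟩; exact ⟨i, by omega, rfl⟩

/-- The walk pentagon has five points. -/
theorem card_wkSet {x0 x1 : E4} (h0 : ‖x0‖ = 1) (h1 : ‖x1‖ = 1) (h01 : inner ℝ x0 x1 = ctwo) :
    (((Finset.range 5).image (wk x0 x1))).card = 5 := by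
  rw [Finset.card_image_of_injOn, Finset.card_range]
  intro i hi j hj hij
  simp only [Finset.coe_range, Set.mem_Iio] at hi hj
  by_contra h
  exact wk_ne h0 h1 h01 (by omega) (by omega) h hij

/-- The walk pentagon lies in `C`. -/
theorem wkSet_subset (hC : IsCode C) {x0 x1 : E4} (hx0 : x0 ∈ C) (hx1 : x1 ∈ C) (h01 : inner ℝ x0 x1 = ctwo) :
    ((Finset.range 5).image (wk x0 x1)) ⊆ C := by
  intro z hz
  obtain ⟨i, hi, rfl⟩ := mem_wkSet.1 hz
  exact wk_mem hC hx0 hx1 h01 i hi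

/-- **Structure theorem.** A ten-point code is the disjoint union of two `144°`-walk pentagons in orthogonal planes:
there are `x₀, x₁, y₀, y₁ ∈ C` with `⟪x₀,x₁⟫ = ⟪y₀,y₁⟫ = c₂`, all `⟪p_i, q_j⟫ = 0`, and `C = {p_i} ∪ {q_j}`. -/
theorem structure_thm (hC : IsCode C) (h10 : C.card = 10) :
    ∃ x0 x1 y0 y1 : E4, x0 ∈ C ∧ x1 ∈ C ∧ y0 ∈ C ∧ y1 ∈ C ∧ inner ℝ x0 x1 = ctwo ∧ inner ℝ y0 y1 = ctwo ∧
      (∀ i j, i ≤ 4 → j ≤ 4 → inner ℝ (wk x0 x1 i) (wk y0 y1 j) = 0) ∧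
      C = ((Finset.range 5).image (wk x0 x1)) ∪ ((Finset.range 5).image (wk y0 y1)) := by
  classical
  -- a first c₂-pair
  have hne : C.Nonempty := by rw [← Finset.card_pos, h10]; norm_num
  obtain ⟨x0, hx0⟩ := hne
  have hd0 : 0 < ((C.erase x0).filter fun y => inner ℝ x0 y = ctwo).card := by
    have := (deg_eq_two hC hx0).1; unfold deg at this; omega
  obtain ⟨x1, hx1f⟩ := Finset.card_pos.1 hd0
  have hx1 : x1 ∈ C := Finset.mem_of_mem_erase (Finset.mem_filter.1 hx1f).1
  have h01 : inner ℝ x0 x1 = ctwo := (Finset.mem_filter.1 hx1f).2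
  have h0 := hC.norm_one x0 hx0
  have h1 := hC.norm_one x1 hx1
  -- a point outside the first pentagon
  have hP5 := card_wkSet h0 h1 h01
  have hPsub := wkSet_subset hC hx0 hx1 h01
  have hrest : (C \ ((Finset.range 5).image (wk x0 x1))).card = 5 := by
    rw [Finset.card_sdiff_of_subset hPsub, h10, hP5]
  obtain ⟨y0, hy0d⟩ := Finset.card_pos.1 (by rw [hrest]; norm_num : 0 < (C \ ((Finset.range 5).image (wk x0 x1))).card)
  have hy0 : y0 ∈ C := (Finset.mem_sdiff.1 hy0d).1
  have hy0P : y0 ∉ ((Finset.range 5).image (wk x0 x1)) := (Finset.mem_sdiff.1 hy0d).2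
  have horth : ∀ {z}, z ∈ C → z ∉ ((Finset.range 5).image (wk x0 x1)) → ∀ i, i ≤ 4 → inner ℝ (wk x0 x1 i) z = 0 := by
    intro z hz hzP
    exact inner_wk_eq_zero hC hx0 hx1 h01 hz (fun i hi h => hzP (mem_wkSet.2 ⟨i, hi, h⟩))
  have hy0orth := horth hy0 hy0P
  -- its c₂-partner, also outside
  have hd1 : 0 < ((C.erase y0).filter fun y => inner ℝ y0 y = ctwo).card := by
    have := (deg_eq_two hC hy0).1; unfold deg at this; omega
  obtain ⟨y1, hy1f⟩ := Finset.card_pos.1 hd1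
  have hy1 : y1 ∈ C := Finset.mem_of_mem_erase (Finset.mem_filter.1 hy1f).1
  have hy01 : inner ℝ y0 y1 = ctwo := (Finset.mem_filter.1 hy1f).2
  -- every point of the second walk is outside the first pentagon (consecutive points are not orthogonal)
  have hg2 := inner_wk (hC.norm_one y0 hy0) (hC.norm_one y1 hy1) hy01
  have hm2 := wk_mem hC hy0 hy1 hy01
  have hout : ∀ j, j ≤ 4 → wk y0 y1 j ∉ ((Finset.range 5).image (wk x0 x1)) := by
    have step : ∀ j, j ≤ 3 → wk y0 y1 j ∉ ((Finset.range 5).image (wk x0 x1)) → wk y0 y1 (j + 1) ∉ ((Finset.range 5).image (wk x0 x1)) := by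
      intro j hj hjout hin
      obtain ⟨i, hi, heq⟩ := mem_wkSet.1 hin
      have hz := horth (hm2 j (by omega)) hjout i hi      -- ⟪p_i, q_j⟫ = 0
      have hc : inner ℝ (wk y0 y1 j) (wk y0 y1 (j + 1)) = ctwo := by
        rw [hg2 j (j + 1) (by omega) (by omega)]
        interval_cases j <;> rfl
      rw [heq, real_inner_comm, hz] at hc
      exact ctwo_neg.ne hc.symm
    intro j hj
    interval_cases j
    · exact hy0P
    · exact step 0 (by norm_num) hy0P
    · exact step 1 (by norm_num) (step 0 (by norm_num) hy0P)
    · exact step 2 (by norm_num) (step 1 (by norm_num) (step 0 (by norm_num) hy0P))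
    · exact step 3 (by norm_num) (step 2 (by norm_num) (step 1 (by norm_num) (step 0 (by norm_num) hy0P)))
  have hcross : ∀ i j, i ≤ 4 → j ≤ 4 → inner ℝ (wk x0 x1 i) (wk y0 y1 j) = 0 :=
    fun i j hi hj => horth (hm2 j hj) (hout j hj) i hi
  refine ⟨x0, x1, y0, y1, hx0, hx1, hy0, hy1, h01, hy01, hcross, ?_⟩
  -- C = P ∪ Q by cardinality
  have hQ5 := card_wkSet (hC.norm_one y0 hy0) (hC.norm_one y1 hy1) hy01
  have hQsub := wkSet_subset hC hy0 hy1 hy01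
  have hdisj : Disjoint (((Finset.range 5).image (wk x0 x1))) (((Finset.range 5).image (wk y0 y1))) := by
    rw [Finset.disjoint_right]
    intro z hz
    obtain ⟨j, hj, rfl⟩ := mem_wkSet.1 hz
    exact hout j hj
  symm
  apply Finset.eq_of_subset_of_card_le (Finset.union_subset hPsub hQsub)
  rw [Finset.card_union_of_disjoint hdisj, hP5, hQ5, h10]

/-- **Uniqueness up to isometry.** Any two ten-point `{0, c₁, c₂}`-codes of `ℝ⁴` with vanishing Gram row sums are
related by a linear isometry of `ℝ⁴`. -/
theorem isometric {C C' : Finset E4} (hC : IsCode C) (h10 : C.card = 10) (hC' : IsCode C') (h10' : C'.card = 10) :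
    ∃ Ψ : E4 ≃ₗᵢ[ℝ] E4, C' = C.image Ψ := by
  classical
  obtain ⟨x0, x1, y0, y1, hx0, hx1, hy0, hy1, h01, hy01, hcr, hCeq⟩ := structure_thm hC h10
  obtain ⟨a0, a1, b0, b1, ha0, ha1, hb0, hb1, ha01, hb01, hcr', hCeq'⟩ := structure_thm hC' h10'
  have hg := inner_wk (hC.norm_one x0 hx0) (hC.norm_one x1 hx1) h01
  have hh := inner_wk (hC.norm_one y0 hy0) (hC.norm_one y1 hy1) hy01
  have hg' := inner_wk (hC'.norm_one a0 ha0) (hC'.norm_one a1 ha1) ha01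
  have hh' := inner_wk (hC'.norm_one b0 hb0) (hC'.norm_one b1 hb1) hb01
  -- labellings by Fin 10
  let v : Fin 10 → E4 := fun a => if (a : ℕ) < 5 then wk x0 x1 a else wk y0 y1 ((a : ℕ) - 5)
  let w : Fin 10 → E4 := fun a => if (a : ℕ) < 5 then wk a0 a1 a else wk b0 b1 ((a : ℕ) - 5)
  have hvw : ∀ a b : Fin 10, inner ℝ (v a) (v b) = inner ℝ (w a) (w b) := by
    intro a b
    have ha := a.2; have hb := b.2
    by_cases ha5 : (a : ℕ) < 5 <;> by_cases hb5 : (b : ℕ) < 5 <;> simp only [v, w, ha5, hb5, if_true, if_false]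
    · rw [hg a b (by omega) (by omega), hg' a b (by omega) (by omega)]
    · rw [hcr a ((b : ℕ) - 5) (by omega) (by omega), hcr' a ((b : ℕ) - 5) (by omega) (by omega)]
    · rw [real_inner_comm, hcr b ((a : ℕ) - 5) (by omega) (by omega), real_inner_comm,
        hcr' b ((a : ℕ) - 5) (by omega) (by omega)]
    · rw [hh ((a : ℕ) - 5) ((b : ℕ) - 5) (by omega) (by omega), hh' ((a : ℕ) - 5) ((b : ℕ) - 5) (by omega) (by omega)]
  obtain ⟨Ψ, hΨ⟩ := Config.exists_linearIsometryEquiv_of_inner_eq v w hvw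
  refine ⟨Ψ, ?_⟩
  -- C.image Ψ ⊆ C' and both have ten elements
  have hsub : C.image Ψ ⊆ C' := by
    intro z hz
    obtain ⟨x, hx, rfl⟩ := Finset.mem_image.1 hz
    rw [hCeq, Finset.mem_union] at hx
    rcases hx with hx | hx
    · obtain ⟨i, hi, rfl⟩ := mem_wkSet.1 hx
      have e := hΨ ⟨i, by omega⟩
      simp only [v, w, show (i : ℕ) < 5 from by omega, if_true] at e
      rw [e, hCeq']
      exact Finset.mem_union_left _ (mem_wkSet.2 ⟨i, hi, rfl⟩)
    · obtain ⟨j, hj, rfl⟩ := mem_wkSet.1 hx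
      have e := hΨ ⟨j + 5, by omega⟩
      simp only [v, w, show ¬ (j + 5 : ℕ) < 5 from by omega, if_false, Nat.add_sub_cancel] at e
      rw [e, hCeq']
      exact Finset.mem_union_right _ (mem_wkSet.2 ⟨j, hj, rfl⟩)
  symm
  apply Finset.eq_of_subset_of_card_le hsub
  rw [Finset.card_image_of_injective _ Ψ.injective, h10, h10']

end code

/-- Constructor from the form delivered by the energy rigidity theorems: unit vectors, inner products of distinct points in
`{0, (√5-1)/4, -(√5+1)/4}`, and `Σ x = 0`. -/
theorem isCode_of {C : Finset E4} (hC : ∀ x ∈ C, ‖x‖ = 1)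
    (hvals : ∀ x ∈ C, ∀ y ∈ C, x ≠ y →
      inner ℝ x y = 0 ∨ inner ℝ x y = (-1 + Real.sqrt 5) / 4 ∨ inner ℝ x y = (-1 - Real.sqrt 5) / 4)
    (hsum : ∑ x ∈ C, x = 0) : IsCode C :=
  ⟨hC, hvals, rowsum_of_sum_eq_zero C hsum⟩

end Summit.Ventures.PackingBounds.Config.OrthogonalPentagonsUnique
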